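import Summits.QuantumFields.YangMills.Theorems.BalabanUVNodesN15KingModelProp39AtZeroField
import HarnessLib

/-!
# BalabanUVNodes ∕ N15 — THE KING-MODEL RUNG, CURVED EDITION (PART Χ-e): KING's (2.17) **EXACT** FOR THE DATUM — the slices of parts Ρ-e∕Χ-a SUM to
# the full `A = 0` propagator: `Σ_{j=0}^{k−1} G^η_{(j)}(x, y) = G^η_k(x, y)` on `T_η = Tor (fine (L^k) M)`, with `G^η_k = King1986.Torus.constrainedProp
# (L^k) M a_k (L^k)² m²` ([Ba 4] (1.6) `G_k(T_ε, 0)` = King (2.13) at `A = 0`, the object of parts O–Ψ), for EVERY `k ≥ 1`, cube `2L^{e_M}`, `m² > 0`;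
# hence the telescoped gradient `Σ_j ∂^η_μG^η_{(j)} = ∂^η_μG^η_k` (the schema's `SliceKernels.dGsum`), and the fine run's re-indexed sum
# `Σ_{j=0}^{k−1} G^{η′}_{(j)} = G^{η′}_{k+n} − Σ_{i<n} G^{η′}_{(i−n)}` («−n ≤ j ≤ k − 1»)
# (Track A, DAG node N15 = NE2; FAN-OUT v1.1 §N15 s3 «KING-MODEL RUNG»)

HONEST FRAMING.  Count-neutral (cell `pub-ymgap`, seat `pub-ymgap-dag-n15-e` g18; `--supports stmt-QuantumFields-27366 --as helper` = K3⁸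
`SpineGivenEndpointR13SepCoPHV`).  TEMPLATE LITERATURE, `A = 0`: C. King's scalar U(1)-Higgs MODEL on finite tori ([King1986] (2.13)–(2.17) p. 653 *"G^ε_k(Ω, A)
= C^{(0),ε}(Ω, A) + Σ_{j=1}^{k−1} … ≡ Σ_{j=0}^{k−1} G^ε_{(j)}(Ω, A)"*, (2.20) p. 654); here PROVED for the tree's objects at `A = 0`, `Ω = T_η`; NOT Bałaban's
covariant objects; NE2⁺ is NOT PRINTED for those and not proved; NOT a node discharge; nothing continuum ∕ ℝ⁴ ∕ OS ∕ mass-gap ∕ Clay.  0 `sorry`, 0 `def`;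
standard axioms.

WHAT THIS REMOVES.  Parts Ρ-e ∕ Ρ-g ∕ Χ-a ∕ Χ-d carried the HONEST-SCOPE line «King's normalisation `(L^jη)^{2−D}` and the (2.20) mass scaling are APPLIED
as the definition of the level-`k` kernel of slice `j`; the telescoped sum (2.17) on `T_η` is not re-proved».  It is proved here: by induction on the
number of levels, part O-a's peel `fullProp_peel'` (= part K `ksSlice_eq_sub` ∘ K-lit `constrainedProp_succ_flatten`: `G_{K+1} ∘ flatten = L^{d+1}∕L²·
(G_K^{sub}(m²∕L²) + ksSlice_K(m²∕L²))`) matches the datum term by term — the top slice `j = k − 1` is the peel's `ksSlice`, every lower slice of the `k`-level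
datum over the cube `2L^{e_M}` at mass `m²` is `L^{d+1}∕L²` times the same slice of the `(k−1)`-level datum over the cube `2L^{e_M+1}` at mass `m²∕L²`
(`kingSliceG_pos_succ`, `kingSliceG_zero_succ`: SAME index `e`, the ratio and mass identities `(L^j∕L^k)^{2−D} = L^{d+1}∕L²·(L^j∕L^{k−1})^{2−D}`,
`m²(L^j∕L^k)² = (m²∕L²)(L^j∕L^{k−1})²`), and the base `k = 1` is `C^{(0),η} = G^η_1` (`kingSliceG_base`).  So the Prop-3.7∕3.9 data of parts Ρ∕Χ ARE King's
slice decompositions (2.17) of THE propagators `G^η_k(T_η, 0)` in continuum units — by theorem, not by dictionary.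
MAIN RESULTS: ★★★ `sum_kingSliceG_eq_constrainedProp`, ★★★ `king217_kingSliceKernels` (schema letters), ★★ `dGsum_kingSliceKernels` (`SliceKernels.dGsum` = the
forward η-gradient of `G^η_k`), ★ `sum_hiG_add_finest_eq` (the fine run: the `k` re-indexed slices plus the `n` finest ones sum to `G^{η′}_{k+n}`).
§1 transport: `constrainedProp_transport`∕`fineOp_inv_transport` (any re-spelling of `N` and of the periods at once).
HONEST SCOPE: `A = 0`, periodic b.c., `L ≥ 2`, `a > 0`, `m² > 0`, `k ≥ 1`, cube `2L^{e_M}`.  WHAT THE CURVED CASE ADDS (one line): (2.17) for `G^ε_k(Ω, A)`,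
`A ≠ 0`, `Ω ⊊ T_ε` — [King1986] (2.13)–(2.17) with `Q_j(A)`, [Ba 1] (2.42)–(2.43) (tree: `B1RG242.StepData.display243`, abstract).
Locators: [King1986] (2.13)–(2.17) p.653, (2.20) p.654, (4.42) p.675; [Balaban1983RegularityDecay] (1.6) p.572.
-/

noncomputable section

namespace Summit.QuantumFields.YangMills.BalabanUVNodes.N15KingModelRung.Curved

open Real Finset Matrix
open Literature.MathematicalPhysics.QuantumFieldTheory.Balaban1983to89.B5Prop11Plancherel (Tor fine unitVec)
open Literature.MathematicalPhysics.QuantumFieldTheory.King1986 (aK)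
open Literature.MathematicalPhysics.QuantumFieldTheory.King1986.Torus (fineOp constrainedProp flatten blockOf tdistT torCongr torCongr_add
  torCongr_unitVec val_torCongr torCongr_refl)
open Literature.MathematicalPhysics.QuantumFieldTheory.King1986.SlicePropagator (SliceKernels)

variable {d : ℕ} (L : ℕ) [NeZero L]

/-! ## §1 Transport along any re-spelling of the carrier -/

section Transport

omit [NeZero L] in
/-- **`G^ε_k` does not see the spelling of its carrier**: for `N = N′` and periods `M μ = M′ μ`, along ANY period identity `h`:
`constrainedProp N′ M′ a c m² (e x) (e y) = constrainedProp N M a c m² x y`. [cite: King1986, (2.13) p.653, (2.20) p.654] -/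
theorem constrainedProp_transport {dd : ℕ} {N N' : ℕ} [NeZero N] [NeZero N'] {M M' : Fin dd → ℕ} [∀ μ, NeZero (M μ)] [∀ μ, NeZero (M' μ)]
    (hN : N = N') (hM : ∀ μ, M μ = M' μ) (h : ∀ μ, fine N M μ = fine N' M' μ) (a c m2 : ℝ) (x y : Tor (fine N M)) :
    constrainedProp N' M' a c m2 (torCongr h x) (torCongr h y) = constrainedProp N M a c m2 x y := by
  subst hN
  obtain rfl : M = M' := funext hM
  rw [torCongr_refl, torCongr_refl]

omit [NeZero L] in
/-- The same for the one-step covariance entries `(A₀)⁻¹`. [cite: King1986, (2.16) p.653, (2.20) p.654] -/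
theorem fineOp_inv_transport {dd : ℕ} {N N' : ℕ} [NeZero N] [NeZero N'] {M M' : Fin dd → ℕ} [∀ μ, NeZero (M μ)] [∀ μ, NeZero (M' μ)]
    (hN : N = N') (hM : ∀ μ, M μ = M' μ) (h : ∀ μ, fine N M μ = fine N' M' μ) (a c m2 : ℝ) (x y : Tor (fine N M)) :
    (fineOp N' M' a c m2)⁻¹ (torCongr h x) (torCongr h y) = (fineOp N M a c m2)⁻¹ x y := by
  subst hN
  obtain rfl : M = M' := funext hM
  rw [torCongr_refl, torCongr_refl]

end Transport

/-! ## §2 The scalar identities of (2.20) -/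

section Scalars

/-- `(L^j∕L^{k+1})^{2−D} = L^{d+1}∕L²·(L^j∕L^k)^{2−D}`: one more level multiplies King's normalisation by `L^{D−2}`. [cite: King1986, (2.20) p.654] -/
theorem sliceRatio_succ_rpow (j k : ℕ) :
    ((L : ℝ) ^ j / (L : ℝ) ^ (k + 1)) ^ ((2 : ℝ) - (d + 1 : ℕ))
      = (L : ℝ) ^ (d + 1) / (L : ℝ) ^ 2 * ((L : ℝ) ^ j / (L : ℝ) ^ k) ^ ((2 : ℝ) - (d + 1 : ℕ)) := by
  have hL0 : (0 : ℝ) < L := by exact_mod_cast Nat.pos_of_ne_zero (NeZero.ne L)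
  have hs : 0 ≤ (L : ℝ) ^ j / (L : ℝ) ^ k := div_nonneg (pow_nonneg hL0.le _) (pow_nonneg hL0.le _)
  have h1 : (L : ℝ) ^ j / (L : ℝ) ^ (k + 1) = ((L : ℝ) ^ j / (L : ℝ) ^ k) / L := by
    rw [pow_succ]; field_simp
  have h2 : (L : ℝ) ^ ((2 : ℝ) - (d + 1 : ℕ)) = (L : ℝ) ^ 2 / (L : ℝ) ^ (d + 1) := by
    rw [Real.rpow_sub hL0, Real.rpow_two, Real.rpow_natCast]
  rw [h1, Real.div_rpow hs hL0.le, h2]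
  field_simp

/-- The same with the finest slice's spelling `1∕L^k`. [cite: King1986, (2.20) p.654] -/
theorem invPow_succ_rpow (k : ℕ) :
    ((1 : ℝ) / (L : ℝ) ^ (k + 1)) ^ ((2 : ℝ) - (d + 1 : ℕ)) = (L : ℝ) ^ (d + 1) / (L : ℝ) ^ 2 * ((1 : ℝ) / (L : ℝ) ^ k) ^ ((2 : ℝ) - (d + 1 : ℕ)) := by
  have h := sliceRatio_succ_rpow (d := d) L 0 k
  rwa [pow_zero] at h

/-- The base normalisation: `(1∕L)^{2−D}·L² = L^{D}`. [cite: King1986, (2.20) p.654] -/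
theorem invPow_one_rpow_mul_sq :
    ((1 : ℝ) / (L : ℝ) ^ 1) ^ ((2 : ℝ) - (d + 1 : ℕ)) * (L : ℝ) ^ 2 = (((L ^ 1 : ℕ) : ℝ)) ^ (d + 1) := by
  have hL0 : (0 : ℝ) < L := by exact_mod_cast Nat.pos_of_ne_zero (NeZero.ne L)
  have h2 : (L : ℝ) ^ ((2 : ℝ) - (d + 1 : ℕ)) = (L : ℝ) ^ 2 / (L : ℝ) ^ (d + 1) := by
    rw [Real.rpow_sub hL0, Real.rpow_two, Real.rpow_natCast]
  rw [pow_one, Real.div_rpow zero_le_one hL0.le, Real.one_rpow, h2]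
  push_cast
  field_simp

end Scalars

/-! ## §3 One level down: the `k`-level datum's slices in terms of the `(k−1)`-level datum's -/

section LevelDown

variable {L} {k eM : ℕ} (M : Fin (d + 1) → ℕ) [∀ μ, NeZero (M μ)]

/-- **THE FINEST SLICE, ONE LEVEL DOWN**: for any cube `M₁` with `M₁_ν = 2L^{e_M+1}` and period identity `h : L^{k+1}·M = L^k·M₁`,
`G^{η}_{(0)}[k+1, M, m²](x, y) = L^{d+1}∕L²·G^{η}_{(0)}[k, M₁, m²∕L²](hx, hy)` — both are `C^{(0)}` over the unit lattice `2L^{e_M+k}` at mass `m²∕L^{2k}`, with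
normalisations `(1∕L^{k+1})^{2−D} = L^{d+1}∕L²·(1∕L^k)^{2−D}`. [cite: King1986, (2.16)–(2.17) p.653, (2.20) p.654] -/
theorem kingSliceG_zero_succ (hM : ∀ μ, M μ = 2 * L ^ eM) (hk : 1 ≤ k) (a msq : ℝ) (M₁ : Fin (d + 1) → ℕ) [∀ μ, NeZero (M₁ μ)]
    (hM₁ : ∀ μ, M₁ μ = 2 * L ^ (eM + 1)) (h : ∀ μ, fine (L ^ (k + 1)) M μ = fine (L ^ k) M₁ μ) (x y : Tor (fine (L ^ (k + 1)) M)) :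
    kingSliceG L (k + 1) eM M hM (one_le_add_of_one_le hk 1) a msq 0 x y
      = (L : ℝ) ^ (d + 1) / (L : ℝ) ^ 2 * kingSliceG L k (eM + 1) M₁ hM₁ hk a (msq / (L : ℝ) ^ 2) 0 (torCongr h x) (torCongr h y) := by
  have hL0 : (0 : ℝ) < L := by exact_mod_cast Nat.pos_of_ne_zero (NeZero.ne L)
  haveI := kingZeroVol_neZero (d := d) L (k + 1) eM
  haveI := kingZeroVol_neZero (d := d) L k (eM + 1)
  rw [kingSliceG_zero, kingSliceG_zero, torCongr_torCongr, torCongr_torCongr, invPow_succ_rpow]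
  -- the two unit volumes agree: `2L^{e_M+(k+1)−1} = 2L^{(e_M+1)+k−1}`
  have hvol : ∀ μ, kingZeroVol (d := d) L (k + 1) eM μ = kingZeroVol (d := d) L k (eM + 1) μ := by
    intro μ
    show 2 * L ^ (eM + (k + 1) - 1) = 2 * L ^ (eM + 1 + k - 1)
    rw [show eM + (k + 1) - 1 = eM + 1 + k - 1 by omega]
  have hmass : msq / (L : ℝ) ^ 2 * (L : ℝ) ^ 2 * ((1 : ℝ) / (L : ℝ) ^ k) ^ 2 = msq * (L : ℝ) ^ 2 * ((1 : ℝ) / (L : ℝ) ^ (k + 1)) ^ 2 := by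
    field_simp; ring
  rw [hmass, ← fineOp_inv_transport (N := L ^ 1) (N' := L ^ 1) rfl hvol
    (fun μ => ((kingZero_carrier L M hM (one_le_add_of_one_le hk 1)) μ).symm.trans
      ((h μ).trans ((kingZero_carrier L M₁ hM₁ hk) μ)))
    _ _ _ (torCongr (kingZero_carrier L M hM (one_le_add_of_one_le hk 1)) x)
    (torCongr (kingZero_carrier L M hM (one_le_add_of_one_le hk 1)) y), torCongr_torCongr, torCongr_torCongr]
  ring

/-- **THE SLICES `1 ≤ j ≤ k − 1`, ONE LEVEL DOWN**: `G^{η}_{(j)}[k+1, M, m²](x, y) = L^{d+1}∕L²·G^{η}_{(j)}[k, M₁, m²∕L²](hx, hy)` — both are part F's `ksSlice`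
at the index `(k + e_M − j, j)`, with `(L^j∕L^{k+1})^{2−D} = L^{d+1}∕L²·(L^j∕L^k)^{2−D}` and `m²(L^j∕L^{k+1})² = (m²∕L²)(L^j∕L^k)²`. [cite: King1986, (2.17) p.653, (2.20) p.654] -/
theorem kingSliceG_pos_succ (hM : ∀ μ, M μ = 2 * L ^ eM) (hk : 1 ≤ k) (a msq : ℝ) (M₁ : Fin (d + 1) → ℕ) [∀ μ, NeZero (M₁ μ)]
    (hM₁ : ∀ μ, M₁ μ = 2 * L ^ (eM + 1)) (h : ∀ μ, fine (L ^ (k + 1)) M μ = fine (L ^ k) M₁ μ) {j : ℕ} (hj : 1 ≤ j) (hjk : j < k)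
    (x y : Tor (fine (L ^ (k + 1)) M)) :
    kingSliceG L (k + 1) eM M hM (one_le_add_of_one_le hk 1) a msq j x y
      = (L : ℝ) ^ (d + 1) / (L : ℝ) ^ 2 * kingSliceG L k (eM + 1) M₁ hM₁ hk a (msq / (L : ℝ) ^ 2) j (torCongr h x) (torCongr h y) := by
  have hL0 : (0 : ℝ) < L := by exact_mod_cast Nat.pos_of_ne_zero (NeZero.ne L)
  have hjk' : j < k + 1 := by omega
  rw [kingSliceG_of_pos M hM _ a msq hj hjk', kingSliceG_of_pos M₁ hM₁ hk a _ hj hjk, torCongr_torCongr, torCongr_torCongr,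
    sliceRatio_succ_rpow]
  have hmass : msq / (L : ℝ) ^ 2 * ((L : ℝ) ^ j / (L : ℝ) ^ k) ^ 2 = msq * ((L : ℝ) ^ j / (L : ℝ) ^ (k + 1)) ^ 2 := by
    field_simp; ring
  rw [hmass, ← ksSlice_reindex L a _ (i₁ := kingSliceIdx (k + 1) eM j hj) (i₂ := kingSliceIdx k (eM + 1) j hj)
    (by show k + 1 + eM - j - 1 = k + (eM + 1) - j - 1; omega) rfl
    (fun μ => ((kingSliceIdx_carrier L M hM hj hjk') μ).symm.trans ((h μ).trans ((kingSliceIdx_carrier L M₁ hM₁ hj hjk) μ)))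
    (torCongr (kingSliceIdx_carrier L M hM hj hjk') x) (torCongr (kingSliceIdx_carrier L M hM hj hjk') y),
    torCongr_torCongr, torCongr_torCongr]
  ring

/-- **THE TOP SLICE `j = k` of the `(k+1)`-level datum IS the peel's piece**: `G^η_{(k)}[k+1, M, m²](x, y) = L^{d+1}∕L²·ksSlice_{(e_M, k)}(m²∕L²)(τx, τy)`
at part Ρ-e's index `kingSliceIdx (k+1) e_M k`. [cite: King1986, (2.17) p.653, (2.20) p.654, (4.42) p.675] -/
theorem kingSliceG_top (hM : ∀ μ, M μ = 2 * L ^ eM) (hk : 1 ≤ k) (a msq : ℝ) (x y : Tor (fine (L ^ (k + 1)) M)) :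
    kingSliceG L (k + 1) eM M hM (one_le_add_of_one_le hk 1) a msq k x y
      = (L : ℝ) ^ (d + 1) / (L : ℝ) ^ 2 *
          ksSlice L a (msq / (L : ℝ) ^ 2) (kingSliceIdx (k + 1) eM k hk)
            (torCongr (kingSliceIdx_carrier L M hM hk (Nat.lt_succ_self k)) x)
            (torCongr (kingSliceIdx_carrier L M hM hk (Nat.lt_succ_self k)) y) := by
  have hL0 : (0 : ℝ) < L := by exact_mod_cast Nat.pos_of_ne_zero (NeZero.ne L)
  have hkk : (0 : ℝ) < (L : ℝ) ^ k := pow_pos hL0 _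
  rw [kingSliceG_of_pos M hM _ a msq hk (Nat.lt_succ_self k), sliceRatio_succ_rpow, div_self hkk.ne', Real.one_rpow, mul_one]
  have hmass : msq * ((L : ℝ) ^ k / (L : ℝ) ^ (k + 1)) ^ 2 = msq / (L : ℝ) ^ 2 := by
    field_simp; ring
  rw [hmass]

/-- **THE PEEL, READ ON THE ONE CARRIER**: for the top index `i₀ = kingSliceIdx (k+1) e_M k` (unit lattice `U = L·2L^{e_M}`) and `τ` the carrier
identity `L^{k+1}·M = L^k·U`: `G^η_{k+1}[M, m²](x, y) = L^{d+1}∕L²·(G_k[U, m²∕L²](τx, τy) + ksSlice_{i₀}(m²∕L²)(τx, τy))` (part O-a `fullProp_peel'` + §1).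
[cite: King1986, (2.13)–(2.17) p.653, (2.20) p.654, (4.42) p.675] -/
theorem fullProp_peel_datum (hL : 2 ≤ L) (hM : ∀ μ, M μ = 2 * L ^ eM) (hk : 1 ≤ k) {a msq : ℝ} (ha : 0 < a) (hmsq : 0 < msq)
    (x y : Tor (fine (L ^ (k + 1)) M)) :
    constrainedProp (L ^ (k + 1)) M (aK a L (k + 1)) (((L ^ (k + 1) : ℕ) : ℝ) ^ 2) msq x y
      = (L : ℝ) ^ (d + 1) / (L : ℝ) ^ 2 *
          (constrainedProp (L ^ k) (ksU L (kingSliceIdx (d := d) (k + 1) eM k hk)) (aK a L k) (((L ^ k : ℕ) : ℝ) ^ 2) (msq / (L : ℝ) ^ 2)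
              (torCongr (kingSliceIdx_carrier L M hM hk (Nat.lt_succ_self k)) x)
              (torCongr (kingSliceIdx_carrier L M hM hk (Nat.lt_succ_self k)) y)
            + ksSlice L a (msq / (L : ℝ) ^ 2) (kingSliceIdx (k + 1) eM k hk)
              (torCongr (kingSliceIdx_carrier L M hM hk (Nat.lt_succ_self k)) x)
              (torCongr (kingSliceIdx_carrier L M hM hk (Nat.lt_succ_self k)) y)) := by
  have h := fullProp_peel' L hL ha hmsq (kingSliceIdx (d := d) (k + 1) eM k hk)
    (torCongr (kingSliceIdx_carrier L M hM hk (Nat.lt_succ_self k)) x) (torCongr (kingSliceIdx_carrier L M hM hk (Nat.lt_succ_self k)) y)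
  -- transport `L^{k+1}, M` to `L^k·L, ksM i₀`
  have hN : L ^ (k + 1) = L ^ (kingSliceIdx (d := d) (k + 1) eM k hk).j * L := by
    show L ^ (k + 1) = L ^ k * L; rw [pow_succ]
  have hMM : ∀ μ, M μ = ksM L (kingSliceIdx (d := d) (k + 1) eM k hk) μ := by
    intro μ
    show M μ = 2 * L ^ (k + 1 + eM - k - 1)
    rw [hM μ, show k + 1 + eM - k - 1 = eM by omega]
  have hc : (((L ^ (k + 1) : ℕ) : ℝ)) ^ 2 = (((L ^ (kingSliceIdx (d := d) (k + 1) eM k hk).j * L : ℕ) : ℝ)) ^ 2 := by rw [hN]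
  have hfin : ∀ μ, fine (L ^ (k + 1)) M μ
      = fine (L ^ (kingSliceIdx (d := d) (k + 1) eM k hk).j * L) (ksM L (kingSliceIdx (d := d) (k + 1) eM k hk)) μ := by
    intro μ
    show L ^ (k + 1) * M μ = L ^ k * L * (2 * L ^ (k + 1 + eM - k - 1))
    rw [hM μ, show k + 1 + eM - k - 1 = eM by omega, pow_succ]
  calc constrainedProp (L ^ (k + 1)) M (aK a L (k + 1)) (((L ^ (k + 1) : ℕ) : ℝ) ^ 2) msq x y
      = constrainedProp (L ^ (kingSliceIdx (d := d) (k + 1) eM k hk).j * L) (ksM L (kingSliceIdx (d := d) (k + 1) eM k hk))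
          (aK a L ((kingSliceIdx (d := d) (k + 1) eM k hk).j + 1))
          (((L ^ (kingSliceIdx (d := d) (k + 1) eM k hk).j * L : ℕ) : ℝ) ^ 2) msq (torCongr hfin x) (torCongr hfin y) := by
        rw [hc]
        exact (constrainedProp_transport hN hMM hfin _ _ _ x y).symm
    _ = _ := by
        rw [flatten_eq_torCongr, flatten_eq_torCongr, torCongr_torCongr, torCongr_torCongr] at h
        exact h

/-- **THE BASE `k = 1`**: the one-level datum's only slice is `C^{(0),η} = G^η_1 = L^{D}·(A₀)⁻¹` — `(1∕L)^{2−D}·L²·(fineOp L M a_1 L² m²)⁻¹ =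
constrainedProp (L^1) M a_1 (L^1)² m²`. [cite: King1986, (2.16)–(2.17) p.653 (j = 0)] -/
theorem kingSliceG_base (hM : ∀ μ, M μ = 2 * L ^ eM) (a msq : ℝ) (x y : Tor (fine (L ^ 1) M)) :
    kingSliceG L 1 eM M hM le_rfl a msq 0 x y = constrainedProp (L ^ 1) M (aK a L 1) (((L ^ 1 : ℕ) : ℝ) ^ 2) msq x y := by
  have hL0 : (0 : ℝ) < L := by exact_mod_cast Nat.pos_of_ne_zero (NeZero.ne L)
  rw [kingSliceG_zero]
  haveI := kingZeroVol_neZero (d := d) L 1 eM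
  have hvol : ∀ μ, kingZeroVol (d := d) L 1 eM μ = M μ := by
    intro μ
    show 2 * L ^ (eM + 1 - 1) = M μ
    rw [hM μ, show eM + 1 - 1 = eM by omega]
  have hmass : msq * (L : ℝ) ^ 2 * ((1 : ℝ) / (L : ℝ) ^ 1) ^ 2 = msq := by field_simp
  rw [hmass, ← fineOp_inv_transport (N := L ^ 1) (N' := L ^ 1) rfl hvol
    (fun μ => ((kingZero_carrier L M hM le_rfl) μ).symm) _ _ _ (torCongr (kingZero_carrier L M hM le_rfl) x)
    (torCongr (kingZero_carrier L M hM le_rfl) y), torCongr_torCongr, torCongr_torCongr, torCongr_refl, torCongr_refl,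
    constrainedProp, Matrix.smul_apply, smul_eq_mul, ← mul_assoc, invPow_one_rpow_mul_sq]

end LevelDown

/-! ## §4 (2.17) for the datum -/

section Telescoped

/-- ★★★ **KING's (2.17) AT `A = 0`, EXACT, FOR THE DATUM**: for `L ≥ 2`, `a > 0` and EVERY `k ≥ 1`, cube `M_ν = 2L^{e_M}`, mass `m² > 0` and `x, y ∈ T_η`:
`Σ_{j=0}^{k−1} G^η_{(j)}(x, y) = G^η_k(x, y)` — the slices of part Ρ-e (`kingSliceG`) sum to King's∕Bałaban's full `A = 0` propagator
`constrainedProp (L^k) M a_k (L^k)² m²` ([Ba 4] (1.6) at `A = 0`; King (2.13)) in continuum units.  Induction on `k`: §3 + part O-a's peel.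
[cite: King1986, (2.13)–(2.17) p.653, (2.20) p.654, (4.42) p.675] -/
theorem sum_kingSliceG_eq_constrainedProp (hL : 2 ≤ L) {a : ℝ} (ha : 0 < a) :
    ∀ (k : ℕ) (hk : 1 ≤ k) (eM : ℕ) (M : Fin (d + 1) → ℕ) [∀ μ, NeZero (M μ)] (hM : ∀ μ, M μ = 2 * L ^ eM) {msq : ℝ}, 0 < msq →
      ∀ x y : Tor (fine (L ^ k) M),
        ∑ j ∈ Finset.range k, kingSliceG L k eM M hM hk a msq j x y
          = constrainedProp (L ^ k) M (aK a L k) (((L ^ k : ℕ) : ℝ) ^ 2) msq x y := by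
  intro k hk
  induction k, hk using Nat.le_induction with
  | base =>
      intro eM M _ hM msq hmsq x y
      rw [Finset.sum_range_one]
      exact kingSliceG_base M hM a msq x y
  | succ k hk IH =>
      intro eM M _ hM msq hmsq x y
      have hL0 : (0 : ℝ) < L := by exact_mod_cast Nat.pos_of_ne_zero (NeZero.ne L)
      -- the sub-cube `U = L·2L^{e_M}` of the top index and the one carrier identity
      have hU : ∀ μ, ksU L (kingSliceIdx (d := d) (k + 1) eM k hk) μ = 2 * L ^ (eM + 1) := by
        intro μ
        show L * (2 * L ^ (k + 1 + eM - k - 1)) = 2 * L ^ (eM + 1)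
        rw [show k + 1 + eM - k - 1 = eM by omega, pow_succ]; ring
      have hsub := IH (eM + 1) (ksU L (kingSliceIdx (d := d) (k + 1) eM k hk)) hU (msq := msq / (L : ℝ) ^ 2) (by positivity)
        (torCongr (kingSliceIdx_carrier L M hM hk (Nat.lt_succ_self k)) x) (torCongr (kingSliceIdx_carrier L M hM hk (Nat.lt_succ_self k)) y)
      rw [Finset.sum_range_succ, fullProp_peel_datum M hL hM hk ha hmsq, ← hsub, mul_add, Finset.mul_sum, kingSliceG_top M hM hk a msq]
      congr 1
      refine Finset.sum_congr rfl fun j hj => ?_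
      rw [Finset.mem_range] at hj
      rcases Nat.eq_zero_or_pos j with rfl | hj1
      · exact kingSliceG_zero_succ M hM hk a msq _ hU _ x y
      · exact kingSliceG_pos_succ M hM hk a msq _ hU _ hj1 hj x y

/-- ★★★ **(2.17) IN THE LETTERS OF THE SCHEMA**: for the Prop.-3.7 datum `D = kingSliceKernels L k e_M M a m²` of parts Ρ-e∕Ρ-g∕Χ,
`Σ_{j < D.k} D.G j x y = G^η_k(x, y)`. [cite: King1986, (2.17) p.653] -/
theorem king217_kingSliceKernels (hL : 2 ≤ L) {a : ℝ} (ha : 0 < a) {k eM : ℕ} (hk : 1 ≤ k) (M : Fin (d + 1) → ℕ) [∀ μ, NeZero (M μ)]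
    (hM : ∀ μ, M μ = 2 * L ^ eM) {msq : ℝ} (hmsq : 0 < msq) (x y : Tor (fine (L ^ k) M)) :
    ∑ j ∈ Finset.range (kingSliceKernels L k eM M hM hk a msq).k, (kingSliceKernels L k eM M hM hk a msq).G j x y
      = constrainedProp (L ^ k) M (aK a L k) (((L ^ k : ℕ) : ℝ) ^ 2) msq x y :=
  sum_kingSliceG_eq_constrainedProp L hL ha k hk eM M hM hmsq x y

/-- ★★ **THE TELESCOPED GRADIENT (2.17)**: the schema's `dGsum` (*"∂^η_μ G^η_k(x, y) = Σ_{j=0}^{k−1} ∂^η_μ G^η_{(j)}(x, y)"*) of the datum IS the forward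
η-gradient of the full propagator: `D.dGsum μ x y = L^k·(G^η_k(x + e_μ, y) − G^η_k(x, y))`. [cite: King1986, (2.17) p.653, p.663 («G^η_k = Σ_{j=0}^{k−1} G^η_{(j)}»)] -/
theorem dGsum_kingSliceKernels (hL : 2 ≤ L) {a : ℝ} (ha : 0 < a) {k eM : ℕ} (hk : 1 ≤ k) (M : Fin (d + 1) → ℕ) [∀ μ, NeZero (M μ)]
    (hM : ∀ μ, M μ = 2 * L ^ eM) {msq : ℝ} (hmsq : 0 < msq) (μ : Fin (d + 1)) (x y : Tor (fine (L ^ k) M)) :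
    (kingSliceKernels L k eM M hM hk a msq).dGsum μ x y
      = (L : ℝ) ^ k * (constrainedProp (L ^ k) M (aK a L k) (((L ^ k : ℕ) : ℝ) ^ 2) msq (x + unitVec (fine (L ^ k) M) μ) y
          - constrainedProp (L ^ k) M (aK a L k) (((L ^ k : ℕ) : ℝ) ^ 2) msq x y) := by
  rw [← sum_kingSliceG_eq_constrainedProp L hL ha k hk eM M hM hmsq, ← sum_kingSliceG_eq_constrainedProp L hL ha k hk eM M hM hmsq,
    ← Finset.sum_sub_distrib, Finset.mul_sum]
  rfl

/-- ★ **THE FINE RUN's BOOKKEEPING «−n ≤ j ≤ k − 1»**: for the re-indexed fine datum of part Χ-a (`hi.G j = G^{η′}_{(j+n)}`), the `k` re-indexed slices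
and the `n` finest ones sum to the full `(k+n)`-level propagator: `Σ_{j<k} T.hi.G j + Σ_{i<n} G^{η′}_{(i)} = G^{η′}_{k+n}`. [cite: King1986, (2.17) p.653, Prop. 3.7 p.663 («Furthermore … −n ≤ j ≤ k − 1»)] -/
theorem sum_hiG_add_finest_eq (hL : 2 ≤ L) {a : ℝ} (ha : 0 < a) {k n eM : ℕ} (hk : 1 ≤ k) (M : Fin (d + 1) → ℕ) [∀ μ, NeZero (M μ)]
    (hM : ∀ μ, M μ = 2 * L ^ eM) {msq : ℝ} (hmsq : 0 < msq) (x' y' : Tor (fine (L ^ (k + n)) M)) :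
    ∑ j ∈ Finset.range k, (kingSlicesTwoSpacing L k n eM M hM hk a msq).hi.G j x' y'
        + ∑ i ∈ Finset.range n, (kingSliceKernels L (k + n) eM M hM (one_le_add_of_one_le hk n) a msq).G i x' y'
      = constrainedProp (L ^ (k + n)) M (aK a L (k + n)) (((L ^ (k + n) : ℕ) : ℝ) ^ 2) msq x' y' := by
  rw [← sum_kingSliceG_eq_constrainedProp L hL ha (k + n) (one_le_add_of_one_le hk n) eM M hM hmsq x' y',
    show Finset.range (k + n) = Finset.range (n + k) by rw [Nat.add_comm], Finset.sum_range_add]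
  have h1 : ∑ j ∈ Finset.range k, (kingSlicesTwoSpacing L k n eM M hM hk a msq).hi.G j x' y'
      = ∑ j ∈ Finset.range k, kingSliceG L (k + n) eM M hM (one_le_add_of_one_le hk n) a msq (n + j) x' y' :=
    Finset.sum_congr rfl fun j _ => by rw [kingSlicesTwoSpacing_hiG, Nat.add_comm j n]
  have h2 : ∑ i ∈ Finset.range n, (kingSliceKernels L (k + n) eM M hM (one_le_add_of_one_le hk n) a msq).G i x' y'
      = ∑ i ∈ Finset.range n, kingSliceG L (k + n) eM M hM (one_le_add_of_one_le hk n) a msq i x' y' := rfl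
  rw [h1, h2, add_comm]

end Telescoped

end Summit.QuantumFields.YangMills.BalabanUVNodes.N15KingModelRung.Curved

end
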